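/-
Copyright (c) 2026 the pub-hodgecm-mathlib formalisation cell (harness21).  Prover seat hodgecm-mathlib-R90-C131-p04 (g3) on the S4 valve (dealer K2E2-plan (g8), S4-R61 (M-2);
design authority K2E4-p11 (g10), MODEL CENSUS 2026-09-05T03:07:17Z), road (J̃♭) MODEL: THE `GLₘ` CAYLEY CHART PACKAGE, THE CHART LINK TO A CENTRALISER TORUS, AND
THE TWIST LETTERS `τ`, for the one-place model `G ≃ GL_m(K)` of the ε-twisted tube-Jacobian socket ★ `R90S4TwistedTubeSocketLoss`.
Crux H413 `stmt-HodgeConjecture-24833`, lane `--supports … --as helper` (count-neutral).  THEOREMS ONLY (no `def`, no `instance`, no notation, no named-fact hypothesis, no `sorry`).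
-/
import Summits.HodgeConjecture.HodgeConjecture.Theorems.F0P3cStCharTSCayleyChartUnitary       -- ★ C4u: `exists_cayley_chart_haar` (brings ★ C4 `continuousOn_chart`, `isOpen_image_chart`, `isCompact_level`, `isOpen_level`, `chart_zero`-free frame)
import Summits.HodgeConjecture.HodgeConjecture.Theorems.F0P3cStCharTSJacCartanModelFrame       -- ★ C8b-frame: `comm_of_cayley_comm`
import Summits.HodgeConjecture.HodgeConjecture.Theorems.R90S4TwistedWeylJacobianAlgebra        -- ★ (TJ1) p864452: `tau_cayley_inv` (brings ★ `JacCartanWeight.tau_add`)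
import Literature.LinearAlgebra.Matrix.CentraliserOfSeparableCharpoly                          -- ★ `Matrix.commute_of_commute_of_charpoly_separable`
import HarnessLib

/-!
# R90-TF · S4 (Ch. 13.1–2) · road (J̃♭) MODEL, FILE (M-2): the `GLₘ` Cayley chart package, the chart link, and the twist letters

Cell `hodgecm-mathlib`, crux H413 (`stmt-HodgeConjecture-24833`, lane `--supports … --as helper`), route of record `HCCMUnconditional` (no route verbs;
count-neutral).  Programme R90-TF, section S4 = [Rogawski1990] Ch. 13.1–13.2 (twisted Weyl integration formula, §12.5 p. 186); seat R90-C131-p04 (g3);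
ORDER = S4 dealer K2E2-plan (g8) S4-R61: (M-2) of the three-hand MODEL cut (K2E4-p11 (g10) (M-1) `R90S4TwistedLinearEquiv`, this file, R90-C131-p05 (g3) (M-3)
`R90S4TwistedTubeModel`).  THEOREMS ONLY — Mathlib + ★ C4∕C4u + ★ C8b-frame + ★ (TJ1) + ★ `CentraliserOfSeparableCharpoly`; ★-only imports.

PURPOSE.  ★ (TL-c′-W) `twistedTubeJacobianLocal_of_chartData_loss` (and ★ W-LOC `twistedTubeJacobianLocal_of_chartData`) are stated in ★ (C4)'s ABSTRACT chart
frame.  (M-3) instantiates them at the one-place model `G ≃ GL_m(K)` (`K = L_w`, `m = Fin 3`, `ρ = localGLPiEvalEquiv`; (κ) of S4-R61: `hloc` is stated over an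
abstract `(G, ρ)`), with `V := Matrix m m K`, `ι := AddMonoidHom.id` (so `ι X = X` definitionally).  This file supplies the GROUP-AGNOSTIC chart-side inputs:
* §1 (β) **`exists_glChart`** — THE `GLₘ` CAYLEY CHART PACKAGE: levels `Λ j = {X | X ≤ α^(j+1)}` (valuation balls of `M_m(K)`), a chart `c` with `ρ (c X) = cayley X`
  on `Λ 0`, the chart product `σV`, continuity of `c` on `Λ 0`, openness of `c(Λ 0)`, and the chart-Haar identity `κ · ν(c B) = μ B` on `Λ 0` with `0 < κ < ∞`
  — ★ C4u `exists_cayley_chart_haar` read at the TRIVIAL FORM `J := 0`, `x := 1`, `ι := id`, `ρ := ρ` (its range letters become `True`: every matrix is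
  «skew for the zero form and commutes with `1`», every `ρ g` is «unitary for the zero form»; no `IsUnit J.det` is asked), then ★ C4 `continuousOn_chart` ∕
  `isOpen_image_chart`; `isClosedEmbedding_addMonoidHom_id` (= the socket's `hι`).
* §2 (δ) **`chart_link_gl`** — THE CHART LINK `c Y ∈ T ↔ pM Y = 0` for `T = ρ⁻¹ Cent(γ)` (`γ` regular) and projections `pM + pT = id` whose `pT` commutes
  with a regular `t` commuting with `γ` and whose `pM` kills the commutant of `t` (at the datum `t = N b₀`, `γ = γ₀`): the commutants of the commuting
  regular `t`, `γ` coincide (★ `commute_of_commute_of_charpoly_separable`) and the Cayley transform commutes with exactly what its argument commutes with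
  (★ `cayley_comm_of_comm`, ★ C8b-frame `comm_of_cayley_comm` at `J := 0`) — twin of ★ `JacCartanElliptic.chart_link` with `Q = 1`.
* §3 (ε) THE TWIST LETTERS for `τ X = J⁻¹ (X.map σ)ᵀ J` and the twist `ε` read in the chart (`ρ (ε g) = J⁻¹ ((ρ g)⁻¹.map σ)ᵀ J`, ★ `coe_unitaryTwist`):
  **`exists_tauHom`** (`τ` as an `AddMonoidHom`, the socket's third slot `E`), **`valBound_tau`** (`τ` preserves the entrywise bounds when `σ` does not
  increase valuations and `J`, `J⁻¹` are integral — the socket's `hE`), **`continuous_tau`** (`hEc`), **`rho_eps_chart_inv_eq_cayley_tau`**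
  (`ρ(ε(c X))⁻¹ = cayley (τ X)` on `Λ 0` — the socket's `hε`; ★ (TJ1) `tau_cayley_inv` + `(cayley (−Y))⁻¹ = cayley Y`).

HONEST LABEL: HC_CM is proved only modulo the 7 printed citations (2 remaining named inputs: hLiu418 = `stmt-HodgeConjecture-24832`, h413 =
`stmt-HodgeConjecture-24833`) until rung 0 closes; this file closes no socket (REL ≠ ★ ≠ BUILT; count-neutral).  The one letter left to the datum: `hσv`
(`σ_w` does not increase `|·|_w`).

## References
* [Rogawski1990] J. D. Rogawski, *Automorphic Representations of Unitary Groups in Three Variables*, Ann. of Math. Stud. 123 (1990), §12.5 p. 186; §3.10 p. 33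
  (the twist `ε`). Context locator.
* [PlatonovRapinchuk1994] V. Platonov, A. Rapinchuk, *Algebraic Groups and Number Theory* (1994), §3.3 (Cayley chart, congruence filtrations). Context locator.
* [Serre1992LALG] J.-P. Serre, *Lie Algebras and Lie Groups*, LNM 1500 (1992), Part II Ch. IV §8–§9. Context locator.
* [HarishChandra1970] Harish-Chandra (notes by G. van Dijk), *Harmonic Analysis on Reductive p-adic Groups*, LNM 162 (1970), Lemma 22. Context locator.
-/

set_option autoImplicit false
-- the mandated namespace repeats the single-problem summit's segment (`HodgeConjecture.HodgeConjecture`)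
set_option linter.dupNamespace false

open Set Filter MeasureTheory MeasureTheory.Measure TopologicalSpace Topology Matrix ValuativeRel
open Literature.NumberTheory.Automorphic Literature.NumberTheory.Weil1982.UnitaryFinTopForm
open Summit.HodgeConjecture.HodgeConjecture.Cruxes.H413.F0P3cStCharTSCayleyChartHaar
open Summit.HodgeConjecture.HodgeConjecture.Cruxes.H413.F0P3cStCharTSCayleyChartUnitary
open Summit.HodgeConjecture.HodgeConjecture.Cruxes.H413.F0P3cStCharTSJacCartanModelFrame
open scoped Pointwise Topology ENNReal NNReal MatrixGroups

namespace Summit.HodgeConjecture.HodgeConjecture.R90.S4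

/-! ## §1 (β) The `GLₘ` Cayley chart package -/

section Chart

variable {K : Type*} [Field K] [ValuativeRel K] [TopologicalSpace K] [IsNonarchimedeanLocalField K]
  {m : Type*} [Fintype m] [DecidableEq m]
  {G : Type*} [Group G] [TopologicalSpace G] [IsTopologicalGroup G] [LocallyCompactSpace G] [SecondCountableTopology G] [T2Space G]
  [MeasurableSpace G] [BorelSpace G]
  (ρ : G →* GL m K)

omit [ValuativeRel K] [IsNonarchimedeanLocalField K] [Fintype m] [DecidableEq m] in
/-- The identity of `M_m(K)` is a closed embedding (the socket's `hι` at `ι := AddMonoidHom.id`). [cite: Serre1992LALG, Part II Ch. IV §9] -/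
theorem isClosedEmbedding_addMonoidHom_id : IsClosedEmbedding ⇑(AddMonoidHom.id (Matrix m m K)) :=
  IsClosedEmbedding.id

/-- **THE `GLₘ` CAYLEY CHART PACKAGE.**  For a topological group `G` identified with `GL_m(K)` by `ρ` (inducing, injective, surjective), radii `0 ≠ α < 1` and
`2 ≠ 0` in the Hausdorff `K`, an additive Haar measure `μ` on `M_m(K)` and a Haar measure `ν` on `G`: there are levels `Λ j = {X | X ≤ α^(j+1)}`, a chart `c : M_m(K) → G` with
`ρ (c X) = cayley X` on `Λ 0`, a chart product `σV` with the Cayley sandwich formula on `Λ 0` and continuous in its second variable, `c` continuous on `Λ 0`, `c(Λ 0)`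
open, and a constant `0 < κ < ∞` with **`κ · ν (c '' B) = μ B`** for every `B ⊆ Λ 0` with Borel image — ★ C4u `exists_cayley_chart_haar` at the trivial form
`J := 0`, `x := 1`, `ι := id`, then ★ C4 `continuousOn_chart` ∕ `isOpen_image_chart`. [cite: PlatonovRapinchuk1994, §3.3] [cite: Serre1992LALG, Part II Ch. IV §9] -/
theorem exists_glChart [T2Space K] [SecondCountableTopology (Matrix m m K)] [MeasurableSpace (Matrix m m K)] [BorelSpace (Matrix m m K)]
    (hρ : IsInducing ρ) (hρinj : Function.Injective ρ) (hρsurj : Function.Surjective ρ)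
    {α : ValueGroupWithZero K} (hα : α ≠ 0) (hα1 : α < 1) (h2 : (2 : K) ≠ 0)
    (μ : Measure (Matrix m m K)) [μ.IsAddHaarMeasure] (ν : Measure G) [ν.IsHaarMeasure] :
    ∃ (Λ : ℕ → AddSubgroup (Matrix m m K)) (c : Matrix m m K → G) (σV : Matrix m m K → Matrix m m K → Matrix m m K) (κ : ℝ≥0∞),
      (∀ j X, X ∈ Λ j ↔ ValBound (α ^ (j + 1)) X) ∧
      (∀ X ∈ Λ 0, ((ρ (c X) : GL m K) : Matrix m m K) = cayley X) ∧
      (∀ W ∈ Λ 0, ∀ X ∈ Λ 0, σV W X = (1 - W)⁻¹ * (W + X) * (1 + W * X)⁻¹ * (1 - W)) ∧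
      (∀ W ∈ Λ 0, ContinuousOn (σV W) (Λ 0 : Set (Matrix m m K))) ∧
      ContinuousOn c (Λ 0 : Set (Matrix m m K)) ∧ IsOpen (c '' (Λ 0 : Set (Matrix m m K))) ∧ κ ≠ 0 ∧ κ ≠ ∞ ∧
      (∀ B ⊆ (Λ 0 : Set (Matrix m m K)), MeasurableSet (c '' B) → κ * ν (c '' B) = μ B) := by
  -- ★ C4u at the trivial form: every matrix is «skew for `J = 0` and commutes with `x = 1`», every `ρ g` is «unitary for `J = 0`»
  have hιr : ∀ X : Matrix m m K, X ∈ Set.range ⇑(AddMonoidHom.id (Matrix m m K)) ↔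
      ((X.map (RingHom.id K))ᵀ * (0 : Matrix m m K) + 0 * X = 0 ∧ X * 1 = 1 * X) := fun X =>
    ⟨fun _ => ⟨by simp, by rw [Matrix.mul_one, Matrix.one_mul]⟩, fun _ => ⟨X, rfl⟩⟩
  have hρr : ∀ g : GL m K, g ∈ Set.range ρ ↔
      ((((g : Matrix m m K)).map (RingHom.id K))ᵀ * (0 : Matrix m m K) * (g : Matrix m m K) = 0 ∧ (g : Matrix m m K) * 1 = 1 * (g : Matrix m m K)) := fun g =>
    ⟨fun _ => ⟨by simp, by rw [Matrix.mul_one, Matrix.one_mul]⟩, fun _ => hρsurj g⟩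
  have h2v : valuation K 2 ≠ 0 := by rwa [Ne, map_eq_zero]
  have hβ0 : valuation K 2 * α ≠ 0 := mul_ne_zero h2v hα
  have hβ : valuation K 2 * α < valuation K 2 := mul_lt_of_lt_one_right (zero_lt_iff.2 h2v) hα1
  have hι : IsClosedEmbedding ⇑(AddMonoidHom.id (Matrix m m K)) := IsClosedEmbedding.id
  haveI : T2Space (Matrix m m K) := inferInstanceAs (T2Space (m → m → K))
  obtain ⟨Λ, c, σV, hΛ, hc, hσV, hσVc, hwin, -, hchart'⟩ :=
    exists_cayley_chart_haar (RingHom.id K) (0 : Matrix m m K) 1 (AddMonoidHom.id (Matrix m m K)) ρ μ ν hι hρ hρinj hιr hρr hα hα1 hβ0 hβ le_rfl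
  have hcc : ContinuousOn c (Λ 0 : Set (Matrix m m K)) := continuousOn_chart (AddMonoidHom.id _) Λ ρ c hι.continuous hΛ hα1 hρ hc
  have hK0 : IsOpen (c '' (Λ 0 : Set (Matrix m m K))) := isOpen_image_chart (AddMonoidHom.id _) Λ ρ c σV hι hΛ hα hα1 hρ hρinj hc hσV hσVc hβ0 hwin
  have hcomp0 : IsCompact (Λ 0 : Set (Matrix m m K)) := isCompact_level (AddMonoidHom.id _) Λ hι hΛ 0
  have hopenΛ := isOpen_level (AddMonoidHom.id _) Λ hι.continuous hΛ hα
  -- the chart constant `κ = μ(Λ 0) ∕ ν(c(Λ 0))`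
  have hμ0 : μ (Λ 0 : Set (Matrix m m K)) ≠ 0 := (hopenΛ 0).measure_ne_zero μ ⟨0, zero_mem _⟩
  have hμt : μ (Λ 0 : Set (Matrix m m K)) ≠ ∞ := hcomp0.measure_lt_top.ne
  have hν0 : ν (c '' (Λ 0 : Set (Matrix m m K))) ≠ 0 := hK0.measure_ne_zero ν ⟨c 0, ⟨0, zero_mem _, rfl⟩⟩
  have hνt : ν (c '' (Λ 0 : Set (Matrix m m K))) ≠ ∞ := (hcomp0.image_of_continuousOn hcc).measure_lt_top.ne
  refine ⟨Λ, c, σV, μ (Λ 0 : Set (Matrix m m K)) / ν (c '' (Λ 0 : Set (Matrix m m K))), hΛ, hc, hσV, hσVc, hcc, hK0,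
    ENNReal.div_ne_zero.2 ⟨hμ0, hνt⟩, ENNReal.div_ne_top hμt hν0, fun B hB hBm => (hchart' B hB hBm).symm⟩

end Chart

/-! ## §2 (δ) The chart link to a centraliser torus -/

section Link

variable {K : Type*} [Field K] [ValuativeRel K] {m : Type*} [Fintype m] [DecidableEq m]
  {G : Type*} [Group G] (ρ : G →* GL m K)

/-- **THE CHART LINK `c Y ∈ T ↔ pM Y = 0`.**  Let `T = {g | ρ g` commutes with `γ}` for a REGULAR `γ ∈ GL_m(K)` (separable characteristic polynomial), let
`t ∈ GL_m(K)` be regular and commute with `γ`, and let `pM + pT = id` be additive projections of `M_m(K)` with `pT Z` commuting with `t` and `pM` killing the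
commutant of `t` (at the datum: `t = N b₀`, `γ = γ₀`, `pM`, `pT` the projections of `M₃ = 𝔷(t) ⊕ (Ad t − 1)M₃`).  Then a chart point `c Y` (`Y ∈ Λ 0`,
`ρ (c Y) = cayley Y`) lies in `T` iff `pM Y = 0`: the commutants of the commuting regular elements `t`, `γ` coincide (★ `commute_of_commute_of_charpoly_separable`)
and `cayley Y` commutes with `γ` iff `Y` does (★ `cayley_comm_of_comm`; ★ C8b-frame `comm_of_cayley_comm` at the trivial form) — twin of ★
`JacCartanElliptic.chart_link` at `Q = 1`. [cite: HarishChandra1970, Lemma 22] [cite: PlatonovRapinchuk1994, §3.3] -/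
theorem chart_link_gl
    {Λ : ℕ → AddSubgroup (Matrix m m K)} {α : ValueGroupWithZero K} (hΛ : ∀ j X, X ∈ Λ j ↔ ValBound (α ^ (j + 1)) X) (hα1 : α < 1) (h2 : (2 : K) ≠ 0)
    (c : Matrix m m K → G) (hc : ∀ X ∈ Λ 0, ((ρ (c X) : GL m K) : Matrix m m K) = cayley X)
    (pM pT : Matrix m m K →+ Matrix m m K) (hsum : ∀ Z, pM Z + pT Z = Z) (t : GL m K)
    (hpTcomm : ∀ Z, pT Z * (t : Matrix m m K) = (t : Matrix m m K) * pT Z)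
    (hkerpM : ∀ X : Matrix m m K, X * (t : Matrix m m K) = (t : Matrix m m K) * X → pM X = 0)
    (hsep : (t : Matrix m m K).charpoly.Separable) {γ : GL m K} (hγsep : (γ : Matrix m m K).charpoly.Separable)
    (htγ : Commute (t : Matrix m m K) (γ : Matrix m m K))
    {T : Subgroup G} (hT : ∀ g, g ∈ T ↔ ρ g * γ = γ * ρ g) :
    (∀ Y ∈ Λ 0, pM Y = 0 → c Y ∈ T) ∧ (∀ W ∈ Λ 0, c W ∈ T → pM W = 0) := by
  have hρcomm : ∀ g : G, g ∈ T ↔ ((ρ g : GL m K) : Matrix m m K) * (γ : Matrix m m K) = (γ : Matrix m m K) * ((ρ g : GL m K) : Matrix m m K) := by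
    intro g
    rw [hT, Units.ext_iff, Units.val_mul, Units.val_mul]
  have hval : ∀ {Y : Matrix m m K}, Y ∈ Λ 0 → ValBound α Y := fun {Y} hY => by
    have h := (hΛ 0 Y).1 hY; rwa [zero_add, pow_one] at h
  constructor
  · intro Y hY hY0
    have hYT : pT Y = Y := by have := hsum Y; rwa [hY0, zero_add] at this
    have hYt : Commute Y (t : Matrix m m K) := by have := hpTcomm Y; rwa [hYT] at this
    have hYγ : Commute Y (γ : Matrix m m K) := Literature.LinearAlgebra.Matrix.commute_of_commute_of_charpoly_separable hsep hYt htγ.symm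
    have hu : IsUnit (1 - Y).det := (isUnit_det_one_sub_of_valBound (hval hY) hα1).1
    rw [hρcomm, hc Y hY]
    exact cayley_comm_of_comm hu hYγ.eq
  · intro W hW hWT
    have hcomm := (hρcomm _).1 hWT
    rw [hc W hW] at hcomm
    have hU' : ((cayley W).map (RingHom.id K))ᵀ * (0 : Matrix m m K) * cayley W = 0 := by rw [Matrix.mul_zero, Matrix.zero_mul]
    have hWγ : Commute W (γ : Matrix m m K) := comm_of_cayley_comm (RingHom.id K) h2 (hval hW) hα1 hU' hcomm
    have hWt : Commute W (t : Matrix m m K) := Literature.LinearAlgebra.Matrix.commute_of_commute_of_charpoly_separable hγsep hWγ htγ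
    exact hkerpM W hWt.eq

end Link

/-! ## §3 (ε) The twist letters: `τ X = J⁻¹ (X.map σ)ᵀ J` and `ε` read in the chart -/

section Twist

variable {K : Type*} [Field K] [ValuativeRel K] {m : Type*} [Fintype m] [DecidableEq m]
  (σ : K →+* K) (J : Matrix m m K)

omit [ValuativeRel K] in
/-- `τ` as an additive homomorphism of `M_m(K)` (the socket's third slot `E`; ★ `tau_add`). [cite: Rogawski1990, §3.10 p. 33] -/
theorem exists_tauHom : ∃ E : Matrix m m K →+ Matrix m m K, ∀ W, E W = J⁻¹ * (W.map σ)ᵀ * J :=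
  ⟨{ toFun := fun W => J⁻¹ * (W.map σ)ᵀ * J
     map_zero' := by simp
     map_add' := fun X Y => Summit.HodgeConjecture.HodgeConjecture.Cruxes.H413.F0P3cStCharTSJacCartanWeight.tau_add σ J X Y }, fun _ => rfl⟩

/-- **`τ` preserves the entrywise bounds** (the socket's `hE`): if `σ` does not increase valuations and `J`, `J⁻¹` are integral then `W ≤ γ ⇒ τ W ≤ γ`
(`(W.map σ)ᵀ ≤ γ` entry by entry; products with integral matrices, `ValBound.mul`). [cite: PlatonovRapinchuk1994, §3.3] -/
theorem valBound_tau (hσv : ∀ x, valuation K (σ x) ≤ valuation K x) (hJ1 : ValBound 1 J) (hJi1 : ValBound 1 J⁻¹)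
    {γ : ValueGroupWithZero K} {W : Matrix m m K} (hW : ValBound γ W) : ValBound γ (J⁻¹ * (W.map σ)ᵀ * J) := by
  have hWσ : ValBound γ (W.map σ)ᵀ := fun i j => by
    rw [Matrix.transpose_apply, Matrix.map_apply]
    exact (hσv _).trans (hW j i)
  simpa only [one_mul, mul_one] using (hJi1.mul hWσ).mul hJ1

omit [ValuativeRel K] in
/-- **`τ` is continuous** (the socket's `hEc`) when `σ` is. [cite: Serre1992LALG, Part II Ch. IV §9] -/
theorem continuous_tau [TopologicalSpace K] [IsTopologicalRing K] (hσ : Continuous σ) :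
    Continuous fun W : Matrix m m K => J⁻¹ * (W.map σ)ᵀ * J :=
  (continuous_const.mul ((Continuous.matrix_map continuous_id hσ).matrix_transpose)).mul continuous_const

variable {G : Type*} [Group G] (ρ : G →* GL m K)

/-- **THE TWIST READ IN THE CHART: `ρ(ε(c X))⁻¹ = cayley (τ X)` on `Λ 0`** (the socket's `hε` with third slot `E := τ`).  Here `ε : G → G` is any map with
`ρ (ε g) = J⁻¹ ((ρ g)⁻¹.map σ)ᵀ J` (★ `coe_unitaryTwist`: `ε(g) = Φ⁻¹ ((σ g)⁻¹)ᵀ Φ`), `J` invertible with `J`, `J⁻¹` integral, `σ` valuation-non-increasing: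
`ρ(ε(c X)) = τ((cayley X)⁻¹) = cayley (−τ X)` (★ (TJ1) `tau_cayley_inv`) and `(cayley (−τX))⁻¹ = cayley (τ X)` (★ `cayley_neg_mul_cayley`).
[cite: Rogawski1990, §3.10 p. 33; §12.5 p. 186] [cite: PlatonovRapinchuk1994, §3.3] -/
theorem rho_eps_chart_inv_eq_cayley_tau (hJ : IsUnit J.det) (hσv : ∀ x, valuation K (σ x) ≤ valuation K x) (hJ1 : ValBound 1 J) (hJi1 : ValBound 1 J⁻¹)
    (ε : G → G) (hερ : ∀ g : G, ((ρ (ε g) : GL m K) : Matrix m m K) = J⁻¹ * ((((ρ g)⁻¹ : GL m K) : Matrix m m K).map σ)ᵀ * J)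
    {Λ : ℕ → AddSubgroup (Matrix m m K)} {α : ValueGroupWithZero K} (hΛ : ∀ j X, X ∈ Λ j ↔ ValBound (α ^ (j + 1)) X) (hα1 : α < 1)
    (c : Matrix m m K → G) (hc : ∀ X ∈ Λ 0, ((ρ (c X) : GL m K) : Matrix m m K) = cayley X) :
    ∀ X ∈ Λ 0, (((ρ (ε (c X)))⁻¹ : GL m K) : Matrix m m K) = cayley (J⁻¹ * (X.map σ)ᵀ * J) := by
  intro X hX
  have hXb : ValBound α X := by have h := (hΛ 0 X).1 hX; rwa [zero_add, pow_one] at h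
  have hτb : ValBound α (J⁻¹ * (X.map σ)ᵀ * J) := valBound_tau σ J hσv hJ1 hJi1 hXb
  have hm : IsUnit (1 - X).det := (isUnit_det_one_sub_of_valBound hXb hα1).1
  have hp : IsUnit (1 + X).det := (isUnit_det_one_add_of_valBound hXb hα1).1
  have hmτ : IsUnit (1 - (J⁻¹ * (X.map σ)ᵀ * J)).det := (isUnit_det_one_sub_of_valBound hτb hα1).1
  have hpτ : IsUnit (1 + J⁻¹ * (X.map σ)ᵀ * J).det := (isUnit_det_one_add_of_valBound hτb hα1).1
  -- `ρ(ε(c X)) = τ((cayley X)⁻¹) = cayley (−τ X)`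
  have hε1 : ((ρ (ε (c X)) : GL m K) : Matrix m m K) = cayley (-(J⁻¹ * (X.map σ)ᵀ * J)) := by
    rw [hερ, Matrix.coe_units_inv, hc X hX, tau_cayley_inv hJ hm hp hpτ]
  -- invert: `(cayley (−Y))⁻¹ = cayley Y`
  rw [Matrix.coe_units_inv, hε1]
  exact Matrix.inv_eq_right_inv (cayley_neg_mul_cayley hmτ hpτ)

end Twist

end Summit.HodgeConjecture.HodgeConjecture.R90.S4
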